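import Literature.MathematicalPhysics.QuantumFieldTheory.Balaban1983to89.B8LeafModelZd3P
import Summits.QuantumFields.YangMills.Theorems.BalabanUVNodesN16PinnedPrintedBondClass
import HarnessLib

/-!
# Route «BalabanUVNodes», cluster K4 «SpineRates» — node N16 = NE3: THE P-CARRIER BRIDGE AT THE PINNED ALL-TORUS MEMBERS — node N05's print-faithful
# member `B8LeafModelZd3P.zdGF3P` ((1.35) ∕ (1.66) in the one-end-point class, (1.37) ∕ (1.42) over print's class `towerBondsP`) IS n05-a's `zdGF3` at every
# pinned member, hence N16's keys 37ᴴ ∕ 38ᴴ ∕ 40ᴮ and the discharge test's `stub_h5` (all read at `zdGF3` pinned) are the P-carrier's statements VERBATIM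

Cell `pub-ymgap`, width seat `pub-ymgap-dag-n16-w2` (g0; director-ym №197 ∕ HUMAN RULING D-0149), node N16.  `--kind proof --supports stmt-QuantumFields-20544 --as helper`
(K3⁷ `SpineGivenEndpointR13SepCoPH`).  `bears_on: R4∕N16 · edge N05 → N16`.

WHY (bus 2026-08-27∕28: this seat's LOCATED-Q1 l.24261 → dag-n05-d p585094 `B8Prop3ShellModeVacuity.not_b8LeafOfRecordSubBH` «node N05's record slot is EMPTY as typed»
→ repair = the P-CARRIER `B8LeafModelZd3P.zdGF3P ∕ zdGF3HP` (dag-n05-w1; design (γ) with dag-n05-w2 ∕ dag-n05-d): (1.35) `avgClose` and (1.66) `avgClose166` guarded by print's p. 77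
one-end-point class `EndBlockIn L (i.Ω j) j z μ`, (1.37)∕(1.42) `C137` over `towerBondsP L i.Ω (i.Λs i.k) j`, every other field `rfl`-equal to `zdGF3`).  Node N16 reads node N05 ONLY at
the PINNED all-torus members (`∀ j, i.Ω j = univ`, `i.Λs m j = {j = m}`, `i.Λb m j = {j = m}`, `i.η = L^{−k}`; modules 37ᴴ `…N16OfEdgesAllTorusAtRecord13CoPH`, 38ᴴ
`…N16OfSocketsAllTorusAtRecord13CoPH`, 40ᴮ `…N16OfThm33LettersAllTorusAtRecord13CoPH`, the evidence file `N16DischargeTest.stub_h5`).  THERE the three re-typed letters are unchanged: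
the one-end-point guard and the old box guard are both trivially true when `Ω_j = ℤᵈ`, and print's class is the canonical class (`…N16PinnedPrintedBondClass.towerBondsP_pinned_eq_lamB`,
this seat's p586422).  So the P-carrier edition is INVISIBLE on N16's keys: this file proves the member EQUALITY `zdGF3P … i = zdGF3 … i` (and `zdGF3HP … i = zdGF3H … i`) at
every pinned member, the equality of the pinned FAMILIES, and the `Iff`s for node N05's two conjuncts `B8.Thm4Body` ∕ `B8.Prop3Body` in N16's letters — so a supplier of
`h5` at the P-carrier closes N16's `h5` by `rw`, and conversely.

WHAT THIS FILE PROVES (kernel bookkeeping; 0 `def`, 0 `sorry`):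
* §1 field agreements at a pinned member: `avgClose_zdGF3P_pinned_eq`, `avgClose166_zdGF3P_pinned_eq` (the guards `EndBlockIn L ℤᵈ …` ∕ «box ⊂ ℤᵈ» are both `True`),
  `C137_zdGF3P_pinned_eq` (`towerBondsP L i.Ω (i.Λs i.k) j = i.Λb i.k j`);
* §2 ★ `zdGF3P_pinned_eq : zdGF3P 𝔸 L β len i = zdGF3 𝔸 L β len i` and ★ `zdGF3HP_pinned_eq : zdGF3HP 𝔸 L β len i = zdGF3H 𝔸 L β len i` (structure update + eta);
* §3 the pinned FAMILIES agree (`zdGF3P_pinnedFamily_eq`, `…_toGFData`, `…_toGFData2`, `zdGF3HP_pinnedFamily_eq`) and ★ `thm4Body_zdGF3P_pinned_iff` ∕ ★ `prop3Body_zdGF3P_pinned_iff`: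
  node N05's [Balaban1985RegularSpaces] Thm 4 ∕ Prop. 3 bodies on the pinned P-family ⟺ on the pinned `zdGF3` family (37ᴴ's `h5` letters), any `d`, `L`, `β`, `len`, constants.

HONEST FRAMING.  `rfl` ∕ `propext` bookkeeping over landed definitions; no estimate; nothing of Bałaban asserted; whether Thm 4 ∕ Prop. 3 HOLD on either carrier is node N05's ∕ N06's
open content (N16's `h5`); **N16 ∕ NE3 NOT discharged**; count-neutral (typed 28∕28 · discharged 5∕27 UNMOVED); one finite four-torus at fixed ε — NOT ℝ⁴, NOT infinite volume,
NOT OS, NOT a mass gap, NOT Clay.  No `sorry`, no `def`, no `instance`, no `notation`.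
-/

set_option autoImplicit false

noncomputable section

namespace Summit.QuantumFields.YangMills.BalabanUVNodes.N16PinnedPCarrierBridge

open Literature.MathematicalPhysics.QuantumFieldTheory.Balaban1983to89
open B7Prop1Explicit
open B8LeafModelZd (ZdIdx)
open B8LeafModelZd3 (zdGF3)
open B8LeafModelZd3H (zdGF3H)
open B8LeafModelZd3P (zdGF3P zdGF3HP EndBlockIn)
open Summit.QuantumFields.YangMills.BalabanUVNodes.N16PinnedPrintedBondClass (towerBondsP_pinned_eq_lamB)

variable {d : ℕ} {𝔸 : Type} [CStarAlgebra 𝔸] {L : ℕ} {β : ℝ} {len : Site d → ℝ}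

/-! ## §1 The three re-typed letters agree with `zdGF3`'s at a pinned member -/

/-- **(1.35) at a pinned member**: the one-end-point guard `EndBlockIn L (Ω j) j z μ` and the box guard «`[loK, bondHiK] ⊂ Ω j`» are both trivially met when `Ω j = ℤᵈ`, so the
P-carrier's `avgClose` IS `zdGF3`'s (as predicates). [cite: Balaban1985RegularSpaces, (1.35) p.82, p.77 («we admit Ω_j = T_η»)] -/
theorem avgClose_zdGF3P_pinned_eq (i : ZdIdx d L) (hΩ : ∀ j, i.Ω j = Set.univ) :
    (zdGF3P 𝔸 L β len i).avgClose = (zdGF3 𝔸 L β len i).avgClose := by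
  funext α U₀ P
  apply propext
  constructor
  · intro h j hj z μ _
    exact h j hj z μ (Or.inl fun x _ => by rw [hΩ j]; exact Set.mem_univ x)
  · intro h j hj z μ _
    exact h j hj z μ (fun x _ => by rw [hΩ j]; exact Set.mem_univ x)

/-- **(1.66) at a pinned member**: likewise for `avgClose166` (its (1.66)₀ side clause is unchanged). [cite: Balaban1985RegularSpaces, (1.66) p.87, p.77] -/
theorem avgClose166_zdGF3P_pinned_eq (i : ZdIdx d L) (hΩ : ∀ j, i.Ω j = Set.univ) :
    (zdGF3P 𝔸 L β len i).avgClose166 = (zdGF3 𝔸 L β len i).avgClose166 := by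
  funext α U₀ P
  apply propext
  constructor
  · intro h
    exact ⟨fun j hj z μ _ => h.1 j hj z μ (Or.inl fun x _ => by rw [hΩ j]; exact Set.mem_univ x), h.2⟩
  · intro h
    exact ⟨fun j hj z μ _ => h.1 j hj z μ (fun x _ => by rw [hΩ j]; exact Set.mem_univ x), h.2⟩

/-- **(1.37)∕(1.42) at a pinned member**: print's class of the member's top tower IS the canonical class (`towerBondsP_pinned_eq_lamB`, p586422), so the P-carrier's `C137` IS
`zdGF3`'s. [cite: Balaban1985RegularSpaces, (1.37) p.82, (1.42) p.83, (1.31) p.82] -/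
theorem C137_zdGF3P_pinned_eq (i : ZdIdx d L) (hΩ : ∀ j, i.Ω j = Set.univ) (hΛs : ∀ m j, i.Λs m j = {_y | j = m})
    (hΛb : ∀ m j, i.Λb m j = {_c | j = m}) :
    (zdGF3P 𝔸 L β len i).C137 = (zdGF3 𝔸 L β len i).C137 := by
  funext α₁ U₀ P
  apply propext
  constructor
  · intro h j hj c hc
    refine h j hj c ?_
    rw [towerBondsP_pinned_eq_lamB i hΩ hΛs hΛb i.k j]
    exact hc
  · intro h j hj c hc
    refine h j hj c ?_
    rw [towerBondsP_pinned_eq_lamB i hΩ hΛs hΛb i.k j] at hc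
    exact hc

/-! ## §2 ★ The P-carrier IS n05-a's member at every pinned member -/

/-- ★ **`zdGF3P … i = zdGF3 … i` AT A PINNED ALL-TORUS MEMBER**: the P-carrier is `zdGF3` updated in exactly the three letters of §1, which agree there; structure eta does the rest.
[cite: Balaban1985RegularSpaces, (1.35) p.82, (1.66) p.87, (1.42) p.83, p.77 (bookkeeping)] -/
theorem zdGF3P_pinned_eq (i : ZdIdx d L) (hΩ : ∀ j, i.Ω j = Set.univ) (hΛs : ∀ m j, i.Λs m j = {_y | j = m})
    (hΛb : ∀ m j, i.Λb m j = {_c | j = m}) : zdGF3P 𝔸 L β len i = zdGF3 𝔸 L β len i := by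
  have hA := avgClose_zdGF3P_pinned_eq (𝔸 := 𝔸) (β := β) (len := len) i hΩ
  have hB := avgClose166_zdGF3P_pinned_eq (𝔸 := 𝔸) (β := β) (len := len) i hΩ
  have hC := C137_zdGF3P_pinned_eq (𝔸 := 𝔸) (β := β) (len := len) i hΩ hΛs hΛb
  calc zdGF3P 𝔸 L β len i
      = { zdGF3 𝔸 L β len i with
            avgClose := (zdGF3P 𝔸 L β len i).avgClose
            avgClose166 := (zdGF3P 𝔸 L β len i).avgClose166
            C137 := (zdGF3P 𝔸 L β len i).C137 } := rfl
    _ = { zdGF3 𝔸 L β len i with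
            avgClose := (zdGF3 𝔸 L β len i).avgClose
            avgClose166 := (zdGF3 𝔸 L β len i).avgClose166
            C137 := (zdGF3 𝔸 L β len i).C137 } := by rw [hA, hB, hC]
    _ = zdGF3 𝔸 L β len i := rfl

/-- ★ **… and `zdGF3HP … i = zdGF3H … i`** (Theorem 8's source space as printed on either side: the P-carrier with n05-c's `InR`). [cite: Balaban1985RegularSpaces, Thm 8 (1.146) p.101 (bookkeeping)] -/
theorem zdGF3HP_pinned_eq (i : ZdIdx d L) (hΩ : ∀ j, i.Ω j = Set.univ) (hΛs : ∀ m j, i.Λs m j = {_y | j = m})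
    (hΛb : ∀ m j, i.Λb m j = {_c | j = m}) : zdGF3HP 𝔸 L β len i = zdGF3H 𝔸 L β len i := by
  have hA := avgClose_zdGF3P_pinned_eq (𝔸 := 𝔸) (β := β) (len := len) i hΩ
  have hB := avgClose166_zdGF3P_pinned_eq (𝔸 := 𝔸) (β := β) (len := len) i hΩ
  have hC := C137_zdGF3P_pinned_eq (𝔸 := 𝔸) (β := β) (len := len) i hΩ hΛs hΛb
  calc zdGF3HP 𝔸 L β len i
      = { zdGF3 𝔸 L β len i with
            avgClose := (zdGF3P 𝔸 L β len i).avgClose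
            avgClose166 := (zdGF3P 𝔸 L β len i).avgClose166
            C137 := (zdGF3P 𝔸 L β len i).C137
            InR := (zdGF3H 𝔸 L β len i).InR } := rfl
    _ = { zdGF3 𝔸 L β len i with
            avgClose := (zdGF3 𝔸 L β len i).avgClose
            avgClose166 := (zdGF3 𝔸 L β len i).avgClose166
            C137 := (zdGF3 𝔸 L β len i).C137
            InR := (zdGF3H 𝔸 L β len i).InR } := by rw [hA, hB, hC]
    _ = zdGF3H 𝔸 L β len i := rfl

/-! ## §3 The pinned families agree; node N05's two conjuncts in N16's letters transfer by `Iff` -/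

/-- **THE PINNED P-FAMILY IS THE PINNED `zdGF3` FAMILY** (N16's index of modules 37ᴴ∕38ᴴ∕40ᴮ and of `stub_h5`). [cite: Balaban1985RegularSpaces, p.77 (bookkeeping)] -/
theorem zdGF3P_pinnedFamily_eq :
    (fun i : {i : ZdIdx d L // (∀ j, i.Ω j = Set.univ) ∧ (∀ m j, i.Λs m j = {_y | j = m}) ∧ (∀ m j, i.Λb m j = {_c | j = m}) ∧ i.η = ((L : ℝ)⁻¹) ^ i.k} =>
        zdGF3P 𝔸 L β len i.1) =
      fun i => zdGF3 𝔸 L β len i.1 :=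
  funext fun i => zdGF3P_pinned_eq i.1 i.2.1 i.2.2.1 i.2.2.2.1

/-- … read on the `GFData` part (Theorem 4's carrier). [cite: Balaban1985RegularSpaces, Thm 4 p.88 (bookkeeping)] -/
theorem zdGF3P_pinnedFamily_toGFData_eq :
    (fun i : {i : ZdIdx d L // (∀ j, i.Ω j = Set.univ) ∧ (∀ m j, i.Λs m j = {_y | j = m}) ∧ (∀ m j, i.Λb m j = {_c | j = m}) ∧ i.η = ((L : ℝ)⁻¹) ^ i.k} =>
        (zdGF3P 𝔸 L β len i.1).toGFData) =
      fun i => (zdGF3 𝔸 L β len i.1).toGFData :=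
  funext fun i => by rw [zdGF3P_pinned_eq i.1 i.2.1 i.2.2.1 i.2.2.2.1]

/-- … read on the `GFData2` part (Proposition 3's carrier). [cite: Balaban1985RegularSpaces, Prop. 3 p.87 (bookkeeping)] -/
theorem zdGF3P_pinnedFamily_toGFData2_eq :
    (fun i : {i : ZdIdx d L // (∀ j, i.Ω j = Set.univ) ∧ (∀ m j, i.Λs m j = {_y | j = m}) ∧ (∀ m j, i.Λb m j = {_c | j = m}) ∧ i.η = ((L : ℝ)⁻¹) ^ i.k} =>
        (zdGF3P 𝔸 L β len i.1).toGFData2) =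
      fun i => (zdGF3 𝔸 L β len i.1).toGFData2 :=
  funext fun i => by rw [zdGF3P_pinned_eq i.1 i.2.1 i.2.2.1 i.2.2.2.1]

/-- The pinned HP-family is the pinned H-family (node N05's repaired-source pin restricted to N16's members). [cite: Balaban1985RegularSpaces, Thm 8 (1.146) p.101 (bookkeeping)] -/
theorem zdGF3HP_pinnedFamily_eq :
    (fun i : {i : ZdIdx d L // (∀ j, i.Ω j = Set.univ) ∧ (∀ m j, i.Λs m j = {_y | j = m}) ∧ (∀ m j, i.Λb m j = {_c | j = m}) ∧ i.η = ((L : ℝ)⁻¹) ^ i.k} =>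
        zdGF3HP 𝔸 L β len i.1) =
      fun i => zdGF3H 𝔸 L β len i.1 :=
  funext fun i => zdGF3HP_pinned_eq i.1 i.2.1 i.2.2.1 i.2.2.2.1

/-- ★ **NODE N05's THEOREM 4 BODY ON THE PINNED P-FAMILY ⟺ ON THE PINNED `zdGF3` FAMILY** (37ᴴ's first `h5` conjunct; any thresholds `c₁`, `B₁′`).
[cite: Balaban1985RegularSpaces, Thm 4 p.88] -/
theorem thm4Body_zdGF3P_pinned_iff (c₁ B₁' : ℝ) :
    B8.Thm4Body c₁ B₁' (fun i : {i : ZdIdx d L // (∀ j, i.Ω j = Set.univ) ∧ (∀ m j, i.Λs m j = {_y | j = m}) ∧ (∀ m j, i.Λb m j = {_c | j = m}) ∧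
        i.η = ((L : ℝ)⁻¹) ^ i.k} => (zdGF3P 𝔸 L β len i.1).toGFData) ↔
      B8.Thm4Body c₁ B₁' (fun i : {i : ZdIdx d L // (∀ j, i.Ω j = Set.univ) ∧ (∀ m j, i.Λs m j = {_y | j = m}) ∧ (∀ m j, i.Λb m j = {_c | j = m}) ∧
        i.η = ((L : ℝ)⁻¹) ^ i.k} => (zdGF3 𝔸 L β len i.1).toGFData) := by
  rw [zdGF3P_pinnedFamily_toGFData_eq]

/-- ★ **NODE N05's PROPOSITION 3 BODY ON THE PINNED P-FAMILY ⟺ ON THE PINNED `zdGF3` FAMILY** (37ᴴ's second `h5` conjunct; any `cP`, `C₂`, `inp`, `B₀β`).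
[cite: Balaban1985RegularSpaces, Prop. 3 p.87] -/
theorem prop3Body_zdGF3P_pinned_iff (cP : ℝ) (C₂ : ℝ) (inp : B8.B9Inputs) (B₀β : ℝ) :
    B8.Prop3Body cP d (L : ℝ) C₂ inp B₀β (fun i : {i : ZdIdx d L // (∀ j, i.Ω j = Set.univ) ∧ (∀ m j, i.Λs m j = {_y | j = m}) ∧ (∀ m j, i.Λb m j = {_c | j = m}) ∧
        i.η = ((L : ℝ)⁻¹) ^ i.k} => (zdGF3P 𝔸 L β len i.1).toGFData2) ↔
      B8.Prop3Body cP d (L : ℝ) C₂ inp B₀β (fun i : {i : ZdIdx d L // (∀ j, i.Ω j = Set.univ) ∧ (∀ m j, i.Λs m j = {_y | j = m}) ∧ (∀ m j, i.Λb m j = {_c | j = m}) ∧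
        i.η = ((L : ℝ)⁻¹) ^ i.k} => (zdGF3 𝔸 L β len i.1).toGFData2) := by
  rw [zdGF3P_pinnedFamily_toGFData2_eq]

end Summit.QuantumFields.YangMills.BalabanUVNodes.N16PinnedPCarrierBridge

end
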